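import Literature.NumberTheory.Automorphic.AdelicAdditiveCharacter
import Literature.NumberTheory.Automorphic.AdicCompletionLocalField
import Literature.NumberTheory.Automorphic.TateLocalFactors
import HarnessLib

/-!
# Global additive characters of `𝔸_K ⧸ K`: the predicate, local components, and Tate's character

Trunk `AutomorphicAxiomatic` (G19), topic `NumberTheory/Automorphic`; namespace `Literature.Automorphic`.
A thin layer on top of `AdelicAdditiveCharacter` (which **constructs** Tate's standard character
`adeleAddChar K = e^{2πiΛ} : 𝔸_K → S¹` and proves it continuous, trivial on `K` and non-trivial,
with local components `adeleAddCharAt K v` trivial on `𝒪_v`), providing what the global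
Rankin–Selberg programme recorded in `RankinSelbergContinuationGlue` (the remaining input of
Jacquet–Shalika's Lemma (5.2) / Thm. (5.3)) quantifies over: an *arbitrary* non-trivial continuous
additive character `ψ` of `𝔸_K` trivial on `K` (Cogdell, *Analytic theory of `L`-functions for
`GL_n`* (2003), §1 and §4: "fix a nontrivial continuous additive character `ψ = ⊗ ψ_v` of `𝔸`
trivial on `k`"), its local components `ψ_v`, and the link to the local predicates of
`TateLocalFactors` on the local fields `K_v` (`AdicCompletionLocalField`).

## Contents

* `IsGlobalAddChar K ψ` (**definition**, a `Prop`-valued structure on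
  `ψ : AddChar (AdeleRing (𝓞 K) K) Circle`): `ψ` is continuous, trivial on the principal adeles
  `algebraMap K 𝔸_K`, and non-trivial. API: `map_add_algebraMap` (`K`-periodicity),
  `exists_apply_ne_one`, and stability under `K^×`-dilation `IsGlobalAddChar.mulShift`
  (`x ↦ ψ(a x)`, `a ∈ K^×`; the easy direction of Tate's Thm. 4.1.4, cf.
  `mulShift_adeleAddChar_algebraMap` of `AdelicAdditiveCharacter` for the standard character).
* `isGlobalAddChar_adeleAddChar` (**proved**): Tate's character is a global additive character
  (`continuous_adeleAddChar`, `adeleAddChar_algebraMap`, `adeleAddChar_ne_one` of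
  `AdelicAdditiveCharacter`); hence `exists_isGlobalAddChar` (**proved**, no hypothesis).
* `AddChar.adicComponent ψ v` (**definition**): the local component `ψ_v = ψ ∘ (K_v ↪ 𝔸_K)` at a
  finite place (`adeleSingleHom K v` of `GLnAdelicStructure`), an
  `AddChar (v.adicCompletion K) Circle`, for a *general* `ψ`; `adeleAddCharAt K v` is
  definitionally `(adeleAddChar K).adicComponent v` (`adeleAddCharAt_eq_adicComponent`, `rfl`).
  `AddChar.archComponent ψ w` at an infinite place likewise (`archSingle K w : K_w →+ 𝔸_K`,
  `continuous_archSingle`). Continuity: `Continuous.adicComponent` / `Continuous.archComponent`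
  (from `continuous_adeleSingleHom` of `AdelicAdditiveCharacter`; the finite-adele form
  `continuous_finiteAdeleSingleHom` is recorded), `IsGlobalAddChar.continuous_adicComponent` /
  `IsGlobalAddChar.continuous_archComponent`.
* Link to `TateLocalFactors` (whose predicates are phrased for an abstract non-archimedean local
  field and apply to `K_v` through the instance `IsNonarchimedeanLocalField (v.adicCompletion K)`
  of `AdicCompletionLocalField`): `IsGlobalAddChar.isContinuousNontrivial_adicComponent`
  (`AddChar.IsContinuousNontrivial`), `AddChar.HasConductorExp.ne_one`,
  `mem_primePowBall_zero_iff` (`𝔭⁰ = 𝒪_v` as subsets of `K_v`) and, **proved** for Tate's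
  character, `adicComponent_adeleAddChar_eq_one` (`ψ_v` is trivial on `𝔭⁰ = 𝒪_v` for every `v`,
  from `adeleAddCharAt_eq_one_of_mem`) — the first half of `HasConductorExp _ 0`.
* `Tate1950_adicComponent_adeleAddChar` (**named fact**): the local components of Tate's
  character are non-trivial at every finite place and of conductor exponent `0`
  (`AddChar.HasConductorExp _ 0`) at all but finitely many — Tate (1950): the component at `𝔭` of
  `e^{2πiΛ}` is the non-trivial character `ξ ↦ e^{2πiΛ_𝔭(ξ)}` of `K_𝔭` (Lemma 2.2.2, Thm. 2.2.1),
  trivial on `η 𝒪_𝔭` iff `η ∈ 𝔡_𝔭⁻¹` (Lemma 2.2.3), and `𝔡_𝔭 = 𝒪_𝔭` for almost all `𝔭` (§4.1).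
  `AdelicAdditiveCharacter` defers exactly this ("the exact conductor (`𝔡_v⁻¹`, Tate Lemma 2.2.3)
  is left to the sequel"); when proved there, `Tate1950_adicComponent_adeleAddChar_holds`
  discharges it. Proved corollaries: `exists_isGlobalAddChar_unramified`,
  `exists_isGlobalAddChar_finset` (a global `ψ` with all `ψ_v ≠ 1`, unramified outside a finite
  set — the shape "`S` large enough that `ψ_v` is unramified for `v ∉ S`" of Jacquet–Shalika
  (1981), (5.1)).

## Design notes

* A predicate on Mathlib's bundled `AddChar _ Circle` rather than a structure carrying `ψ`: the
  consumers (`whittakerCharFun ψ` of `WhittakerModels`, stated over any commutative ring and so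
  applicable verbatim to `R = AdeleRing (𝓞 K) K`; the `ψ : AddChar F Circle` parameters of
  `TateLocalFactors`, `RankinSelbergLocal`) take a bare `AddChar`, and theorems take
  `(hψ : IsGlobalAddChar K ψ)`.
* Non-triviality is `ψ ≠ 1` (`AddChar.ne_one_iff`; Mathlib's `0 : AddChar` is definitionally the
  same trivial character, cf. `AddChar.IsContinuousNontrivial`).
* Non-vacuity: `isGlobalAddChar_adeleAddChar`.

## References

* J. T. Tate, *Fourier analysis in number fields and Hecke's zeta-functions* (1950), in:
  J. W. S. Cassels, A. Fröhlich (eds.), *Algebraic Number Theory* (1967), Ch. XV: §2.2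
  (Lemma 2.2.1–2.2.3, Thm. 2.2.1; held copy `book:editornd-algebraic-number-theory`, PDF
  pp. 335–336), §4.1 (Thm. 4.1.1 p. 356, Lemma 4.1.5 p. 358, Thm. 4.1.4 p. 359; "`𝔡_𝔭 = 𝒪_𝔭` for
  almost all `𝔭`", p. 355) [Tate1950] [CasselsFrohlichANT1967].
* J. W. Cogdell, *Analytic theory of `L`-functions for `GL_n`*, in: J. Bernstein, S. Gelbart
  (eds.), *An Introduction to the Langlands Program*, Birkhäuser (2003), §1, §4.
* H. Jacquet, J. A. Shalika, *On Euler products and the classification of automorphic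
  representations I*, Amer. J. Math. 103 (1981), (5.1) [JacquetShalikaAJM1981].
-/

noncomputable section

open scoped RestrictedProduct
open NumberField IsDedekindDomain Filter Topology

namespace Literature.NumberTheory.Automorphic

/-! ### Factor inclusions -/

section Single

variable (K : Type) [Field K] [NumberField K] (v : HeightOneSpectrum (𝓞 K))

/-- The factor inclusion `K_v → 𝔸_K^∞`, `x ↦ (x at v, 0 elsewhere)` (`finiteAdeleSingleHom`, i.e.
`RestrictedProduct.single`) is continuous: it is the finite-adele component of the continuous
`adeleSingleHom K v` (`continuous_adeleSingleHom`, `AdelicAdditiveCharacter`). [folklore] -/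
theorem continuous_finiteAdeleSingleHom : Continuous (finiteAdeleSingleHom K v) :=
  continuous_snd.comp (continuous_adeleSingleHom K v)

open scoped Classical in
/-- The factor inclusion `K_w → 𝔸_K`, `x ↦ ((x at w, 0 at the other infinite places), 0)` of an
archimedean completion, as an additive homomorphism. [folklore] -/
def archSingle (w : InfinitePlace K) : w.Completion →+ AdeleRing (𝓞 K) K :=
  (AddMonoidHom.inl (InfiniteAdeleRing K) (FiniteAdeleRing (𝓞 K) K)).comp
    (AddMonoidHom.single (fun w : InfinitePlace K => w.Completion) w)

open scoped Classical in
/-- `archSingle K w x = (Pi.single w x, 0)`. [folklore] -/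
theorem archSingle_apply (w : InfinitePlace K) (x : w.Completion) :
    archSingle K w x = ((Pi.single w x : InfiniteAdeleRing K), (0 : FiniteAdeleRing (𝓞 K) K)) :=
  rfl

open scoped Classical in
/-- The archimedean factor inclusion `K_w → 𝔸_K` is continuous. [folklore] -/
theorem continuous_archSingle (w : InfinitePlace K) : Continuous (archSingle K w) := by
  have : (archSingle K w : w.Completion → AdeleRing (𝓞 K) K) =
      fun x => ((Pi.single w x : InfiniteAdeleRing K), (0 : FiniteAdeleRing (𝓞 K) K)) :=
    funext fun x => archSingle_apply K w x
  rw [this]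
  exact (continuous_single w).prodMk continuous_const

end Single

/-! ### Global additive characters -/

section Global

variable (K : Type) [Field K] [NumberField K]

/-- A **global additive character** of the number field `K`: a continuous unitary character
`ψ : 𝔸_K → 𝕊` of the adele ring which is trivial on the principal adeles `K ↪ 𝔸_K` and
non-trivial — i.e. a non-trivial continuous character of the compact group `𝔸_K ⧸ K`. Tate's
`x ↦ e^{2πi Λ(x)}` (Tate (1950), §4.1: Thm. 4.1.1, Lemma 4.1.5) is one; by Thm. 4.1.4 loc. cit.
every other is `x ↦ e^{2πi Λ(ξ x)}` with `ξ ∈ K^×`. This is the datum "fix a non-trivial continuous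
additive character `ψ` of `𝔸` trivial on `k`" of the theory of Whittaker–Fourier expansions and
Rankin–Selberg integrals (Cogdell (2003), §1, §4). [cite: Tate1950, §4.1, Thm. 4.1.1, Lemma 4.1.5] -/
structure IsGlobalAddChar (ψ : AddChar (AdeleRing (𝓞 K) K) Circle) : Prop where
  /-- `ψ` is continuous. -/
  continuous : Continuous ψ
  /-- `ψ` is trivial on the principal adeles. -/
  map_algebraMap : ∀ k : K, ψ (algebraMap K (AdeleRing (𝓞 K) K) k) = 1
  /-- `ψ` is not the trivial character. -/
  ne_one : ψ ≠ 1

namespace IsGlobalAddChar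

variable {K} {ψ : AddChar (AdeleRing (𝓞 K) K) Circle}

/-- A global additive character is `K`-periodic: `ψ(x + k) = ψ(x)` for `k ∈ K`. [folklore] -/
theorem map_add_algebraMap (hψ : IsGlobalAddChar K ψ) (x : AdeleRing (𝓞 K) K) (k : K) :
    ψ (x + algebraMap K (AdeleRing (𝓞 K) K) k) = ψ x := by
  rw [AddChar.map_add_eq_mul, hψ.map_algebraMap, mul_one]

/-- `ψ(k + x) = ψ(x)` for `k ∈ K`. [folklore] -/
theorem map_algebraMap_add (hψ : IsGlobalAddChar K ψ) (k : K) (x : AdeleRing (𝓞 K) K) :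
    ψ (algebraMap K (AdeleRing (𝓞 K) K) k + x) = ψ x := by
  rw [add_comm, hψ.map_add_algebraMap]

/-- A global additive character takes some value `≠ 1`. [folklore] -/
theorem exists_apply_ne_one (hψ : IsGlobalAddChar K ψ) : ∃ x : AdeleRing (𝓞 K) K, ψ x ≠ 1 :=
  AddChar.ne_one_iff.1 hψ.ne_one

end IsGlobalAddChar

variable {K} in
/-- **Dilating a global additive character by `a ∈ K^×` gives a global additive character**:
`x ↦ ψ(a x)` (`AddChar.mulShift`) is continuous, trivial on `K` (as `a K = K`) and non-trivial
(as `a` is a unit of `𝔸_K`). This is the easy direction of Tate (1950), Thm. 4.1.4 with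
Lemma 2.2.1 / Thm. 4.1.1 ("`η ↔ X(η ξ)`"). [cite: Tate1950, Thm. 4.1.1, Thm. 4.1.4] -/
theorem IsGlobalAddChar.mulShift {ψ : AddChar (AdeleRing (𝓞 K) K) Circle}
    (hψ : IsGlobalAddChar K ψ) {a : K} (ha : a ≠ 0) :
    IsGlobalAddChar K (ψ.mulShift (algebraMap K (AdeleRing (𝓞 K) K) a)) where
  continuous := by
    have : ((ψ.mulShift (algebraMap K (AdeleRing (𝓞 K) K) a) : AddChar _ Circle) :
        AdeleRing (𝓞 K) K → Circle) = fun x => ψ (algebraMap K (AdeleRing (𝓞 K) K) a * x) := by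
      funext x; exact AddChar.mulShift_apply
    rw [this]
    exact hψ.continuous.comp (continuous_const.mul continuous_id)
  map_algebraMap k := by
    rw [AddChar.mulShift_apply, ← map_mul, hψ.map_algebraMap]
  ne_one := by
    obtain ⟨x, hx⟩ := hψ.exists_apply_ne_one
    rw [AddChar.ne_one_iff]
    refine ⟨algebraMap K (AdeleRing (𝓞 K) K) a⁻¹ * x, ?_⟩
    rwa [AddChar.mulShift_apply, ← mul_assoc, ← map_mul, mul_inv_cancel₀ ha, map_one, one_mul]


/-- **Tate's standard character is a global additive character**: `adeleAddChar K = e^{2πiΛ}` is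
continuous (`continuous_adeleAddChar`), trivial on `K` (`adeleAddChar_algebraMap`, Tate's
Lemma 4.1.5) and non-trivial (`adeleAddChar_ne_one`), all proved in `AdelicAdditiveCharacter`.
[cite: Tate1950, Thm. 4.1.1, Lemma 4.1.5] -/
theorem isGlobalAddChar_adeleAddChar : IsGlobalAddChar K (adeleAddChar K) where
  continuous := continuous_adeleAddChar K
  map_algebraMap := adeleAddChar_algebraMap K
  ne_one := AddChar.ne_one_iff.2 ⟨_, adeleAddChar_ne_one K⟩

/-- In particular **a global additive character exists**. [cite: Tate1950, Thm. 4.1.1, Lemma 4.1.5] -/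
theorem exists_isGlobalAddChar :
    ∃ ψ : AddChar (AdeleRing (𝓞 K) K) Circle, IsGlobalAddChar K ψ :=
  ⟨adeleAddChar K, isGlobalAddChar_adeleAddChar K⟩

end Global

/-! ### Local components -/

section LocalComponents

variable {K : Type} [Field K] [NumberField K]

/-- The **local component** `ψ_v = ψ ∘ (K_v ↪ 𝔸_K)` of an additive character `ψ` of `𝔸_K` at a
finite place `v`: an additive character of the completion `K_v` (Tate (1950), §3.1–§4.1: a
character of the restricted direct product restricts to the factors, `ψ = ∏_v ψ_v`; Cogdell
(2003), §1: `ψ = ⊗ ψ_v`). [cite: Tate1950, §4.1] -/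
def _root_.AddChar.adicComponent (ψ : AddChar (AdeleRing (𝓞 K) K) Circle)
    (v : HeightOneSpectrum (𝓞 K)) : AddChar (v.adicCompletion K) Circle :=
  ψ.compAddMonoidHom (adeleSingleHom K v : v.adicCompletion K →+ AdeleRing (𝓞 K) K)

/-- `ψ_v x = ψ (x at v, 0 elsewhere)`. [folklore] -/
theorem _root_.AddChar.adicComponent_apply (ψ : AddChar (AdeleRing (𝓞 K) K) Circle)
    (v : HeightOneSpectrum (𝓞 K)) (x : v.adicCompletion K) :
    ψ.adicComponent v x = ψ (adeleSingleHom K v x) :=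
  rfl

/-- The **archimedean local component** `ψ_w = ψ ∘ (K_w ↪ 𝔸_K)` at an infinite place `w`.
[cite: Tate1950, §4.1] -/
def _root_.AddChar.archComponent (ψ : AddChar (AdeleRing (𝓞 K) K) Circle) (w : InfinitePlace K) :
    AddChar w.Completion Circle :=
  ψ.compAddMonoidHom (archSingle K w)

/-- `ψ_w x = ψ ((x at w, 0 elsewhere), 0)`. [folklore] -/
theorem _root_.AddChar.archComponent_apply (ψ : AddChar (AdeleRing (𝓞 K) K) Circle)
    (w : InfinitePlace K) (x : w.Completion) :
    ψ.archComponent w x = ψ (archSingle K w x) :=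
  rfl

/-- The local components of a continuous character are continuous. [folklore] -/
theorem _root_.Continuous.adicComponent {ψ : AddChar (AdeleRing (𝓞 K) K) Circle}
    (hψ : Continuous ψ) (v : HeightOneSpectrum (𝓞 K)) : Continuous (ψ.adicComponent v) :=
  hψ.comp (continuous_adeleSingleHom K v)

/-- The archimedean components of a continuous character are continuous. [folklore] -/
theorem _root_.Continuous.archComponent {ψ : AddChar (AdeleRing (𝓞 K) K) Circle}
    (hψ : Continuous ψ) (w : InfinitePlace K) : Continuous (ψ.archComponent w) :=
  hψ.comp (continuous_archSingle K w)

/-- The local components of a global additive character are continuous. [folklore] -/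
theorem IsGlobalAddChar.continuous_adicComponent {ψ : AddChar (AdeleRing (𝓞 K) K) Circle}
    (hψ : IsGlobalAddChar K ψ) (v : HeightOneSpectrum (𝓞 K)) : Continuous (ψ.adicComponent v) :=
  hψ.continuous.adicComponent v

/-- The archimedean components of a global additive character are continuous. [folklore] -/
theorem IsGlobalAddChar.continuous_archComponent {ψ : AddChar (AdeleRing (𝓞 K) K) Circle}
    (hψ : IsGlobalAddChar K ψ) (w : InfinitePlace K) : Continuous (ψ.archComponent w) :=
  hψ.continuous.archComponent w

/-- The non-trivial local components of a global additive character are non-trivial continuous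
additive characters of the local field `K_v` in the sense of `AddChar.IsContinuousNontrivial`
(`TateLocalFactors`; Mathlib's `0 : AddChar` is the trivial character `1`). [folklore] -/
theorem IsGlobalAddChar.isContinuousNontrivial_adicComponent
    {ψ : AddChar (AdeleRing (𝓞 K) K) Circle} (hψ : IsGlobalAddChar K ψ)
    {v : HeightOneSpectrum (𝓞 K)} (hv : ψ.adicComponent v ≠ 1) :
    (ψ.adicComponent v).IsContinuousNontrivial :=
  ⟨hψ.continuous_adicComponent v, hv⟩

/-- An additive character of a non-archimedean local field with a conductor exponent
(`AddChar.HasConductorExp φ m`: trivial on `𝔭^m`, not on `𝔭^{m-1}`) is non-trivial; in particular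
a local component of conductor exponent `0` is. [folklore] -/
theorem _root_.AddChar.HasConductorExp.ne_one {F : Type*} [Field F] [ValuativeRel F]
    [TopologicalSpace F] [IsNonarchimedeanLocalField F] {φ : AddChar F Circle} {m : ℤ}
    (h : φ.HasConductorExp m) : φ ≠ 1 := by
  obtain ⟨x, -, hx⟩ := h.2
  exact AddChar.ne_one_iff.2 ⟨x, hx⟩

/-- The local component `adeleAddCharAt K v` of `AdelicAdditiveCharacter` **is**
`(adeleAddChar K).adicComponent v` (definitionally). [folklore] -/
theorem adeleAddCharAt_eq_adicComponent (v : HeightOneSpectrum (𝓞 K)) :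
    adeleAddCharAt K v = (adeleAddChar K).adicComponent v :=
  rfl

/-- `𝔭⁰ = 𝒪_v`: the ball `primePowBall K_v 0 = {x | |x|_v ≤ 1}` of `TateLocalFactors` is the ring
of integers `v.adicCompletionIntegers K = {x | v(x) ≤ 1}` (the normalised absolute value and
`Valued.v` define the same valuation ring: `normAbs_le_one_iff` and the compatibility of `Valued.v`
with the valuative relation of `K_v`). [folklore] -/
theorem mem_primePowBall_zero_iff {v : HeightOneSpectrum (𝓞 K)} (x : v.adicCompletion K) :
    x ∈ primePowBall (v.adicCompletion K) 0 ↔ x ∈ v.adicCompletionIntegers K := by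
  rw [HeightOneSpectrum.mem_adicCompletionIntegers,
    ← Valuation.vle_one_iff (Valued.v : Valuation (v.adicCompletion K) (WithZero (Multiplicative ℤ))),
    Valuation.vle_one_iff (ValuativeRel.valuation (v.adicCompletion K)),
    ← Valuation.mem_integer_iff]
  change Literature.NumberTheory.GaloisRepresentations.IsNonarchimedeanLocalField.normAbs (v.adicCompletion K) x ≤ _ ↔ _
  rw [zpow_zero, Literature.NumberTheory.GaloisRepresentations.IsNonarchimedeanLocalField.normAbs_le_one_iff]

/-- **The local components of Tate's character are trivial on `𝔭⁰ = 𝒪_v`, for every `v`** — the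
first half of `AddChar.HasConductorExp _ 0` — from `adeleAddCharAt_eq_one_of_mem` of
`AdelicAdditiveCharacter`. [folklore] -/
theorem adicComponent_adeleAddChar_eq_one {v : HeightOneSpectrum (𝓞 K)} {x : v.adicCompletion K}
    (hx : x ∈ primePowBall (v.adicCompletion K) 0) : (adeleAddChar K).adicComponent v x = 1 :=
  adeleAddCharAt_eq_one_of_mem K v ((mem_primePowBall_zero_iff x).1 hx)

end LocalComponents



/-! ### The local components of Tate's character: a named fact, and corollaries -/

section Tate

variable (K : Type) [Field K] [NumberField K]

/-- **Tate (1950): the local components of the standard character are non-trivial everywhere and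
unramified almost everywhere.** For Tate's character `ψ_K = e^{2πiΛ}` of `𝔸_K`
(`adeleAddChar K` of `AdelicAdditiveCharacter`), the component at a finite place `𝔭`
(`(adeleAddChar K).adicComponent v = adeleAddCharAt K v`) is the character
`ξ ↦ e^{2πiΛ_𝔭(ξ)}`, `Λ_𝔭 = λ_p ∘ Tr_{K_𝔭/ℚ_p}`, of `K_𝔭`, which is **non-trivial** (Lemma 2.2.2,
Thm. 2.2.1: "`ξ → e^{2πiΛ(ξ)}` is a non-trivial character of `k⁺`"), and is trivial on `η 𝒪_𝔭` iff
`η ∈ 𝔡_𝔭⁻¹`, `𝔡_𝔭` the absolute different (Lemma 2.2.3); since `𝔡_𝔭 = 𝒪_𝔭` for almost all `𝔭`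
(§4.1, p. 355 of the held copy), for all but finitely many `v` it is trivial on `𝒪_v = 𝔭⁰` and
not on `𝔭⁻¹`, i.e. has **conductor exponent `0`** (`AddChar.HasConductorExp _ 0` of
`TateLocalFactors`). Triviality on `𝒪_v` (for every `v`) is already the theorem
`adicComponent_adeleAddChar_eq_one`; the remaining content is the non-triviality on `𝔭⁻¹` almost
everywhere and the non-triviality everywhere, deferred by `AdelicAdditiveCharacter` to its sequel.
[cite: Tate1950, Lemma 2.2.2, Thm. 2.2.1, Lemma 2.2.3] -/
def Tate1950_adicComponent_adeleAddChar : Prop :=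
  (∀ v : HeightOneSpectrum (𝓞 K), (adeleAddChar K).adicComponent v ≠ 1) ∧
    ∀ᶠ v : HeightOneSpectrum (𝓞 K) in cofinite, ((adeleAddChar K).adicComponent v).HasConductorExp 0

/-- Corollary: **there is a global additive character with non-trivial local components,
unramified almost everywhere** (namely Tate's). [cite: Tate1950, Thm. 4.1.1, Lemma 4.1.5, Lemma 2.2.3] -/
theorem exists_isGlobalAddChar_unramified (h : Tate1950_adicComponent_adeleAddChar K) :
    ∃ ψ : AddChar (AdeleRing (𝓞 K) K) Circle, IsGlobalAddChar K ψ ∧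
      (∀ v : HeightOneSpectrum (𝓞 K), ψ.adicComponent v ≠ 1) ∧
        ∀ᶠ v : HeightOneSpectrum (𝓞 K) in cofinite, (ψ.adicComponent v).HasConductorExp 0 :=
  ⟨adeleAddChar K, isGlobalAddChar_adeleAddChar K, h.1, h.2⟩

/-- Corollary form with a **finite exceptional set** `S₀` of finite places (the shape used to
enlarge the exceptional set `S` in Rankin–Selberg arguments, Jacquet–Shalika (1981), (5.1): "`S`
large enough that `ψ_v` is unramified for `v ∉ S`"). [cite: Tate1950, Lemma 2.2.3] -/
theorem exists_isGlobalAddChar_finset (h : Tate1950_adicComponent_adeleAddChar K) :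
    ∃ (ψ : AddChar (AdeleRing (𝓞 K) K) Circle) (S₀ : Finset (HeightOneSpectrum (𝓞 K))),
      IsGlobalAddChar K ψ ∧ (∀ v, ψ.adicComponent v ≠ 1) ∧
        ∀ v ∉ S₀, (ψ.adicComponent v).HasConductorExp 0 := by
  obtain ⟨hne, hun⟩ := h
  rw [eventually_cofinite] at hun
  refine ⟨adeleAddChar K, hun.toFinset, isGlobalAddChar_adeleAddChar K, hne, fun v hv => ?_⟩
  by_contra hv'
  exact hv (hun.mem_toFinset.2 hv')

end Tate

end Literature.NumberTheory.Automorphic
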